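import Summits.Ventures.HodgeRepro.FaceCensusEngine
import Summits.Ventures.HodgeRepro.EngineMasks

/-!
# EngineTypes — `cmTypes.length = 2 ^ (n / 2)` for every Galois CM type (seat p4)

The CM types of `(G, c)` are in bijection with the subsets of a transversal `R` of the places `{g, c g}`
(take `R = {a | a < c a}` in the `Fin n` order): a CM type is recorded by its bits on `R`, and every subset
of `R` extends uniquely to a CM type.  Hence `Γ.cmTypes.length = 2 ^ (n / 2)`.  (Part 5 of p4's generic
engine lemmas; with `places_length`, `faces_length` every count in the census rows is a closed formula.)
The transversal is written out as `Finset.univ.filter fun a => a < Γ.mul Γ.conj a`, the bits of a type on it as the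
filter `… .filter fun a => mem a T = true`, the mask of a finset `A` as the fold
`(List.finRange n).foldl (fun acc i => if i ∈ A then acc ||| bit i else acc) 0` (kit v4: no auxiliary definitions,
every file of the kit is a pure proof file).
-/

namespace Summit.Ventures.HodgeRepro.FaceCensus

/-! ### Masks of finsets -/

section MaskOf

variable {n : ℕ}

/-- Invariant of the `foldl` computing `maskOf`. -/
theorem mem_foldl_maskOf (A : Finset (Fin n)) (i : Fin n) (L : List (Fin n)) (acc : ℕ) :
    mem i (L.foldl (fun acc j => if j ∈ A then acc ||| bit j else acc) acc) =
      (mem i acc || L.any fun j => decide (j ∈ A) && decide (j = i)) := by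
  induction L generalizing acc with
  | nil => simp
  | cons j L ih =>
    simp only [List.foldl_cons, List.any_cons]
    rw [ih]
    by_cases h : j ∈ A
    · simp [h, mem_or, mem_bit, Bool.or_assoc, eq_comm]
    · simp [h]

/-- Bit `i` of `((List.finRange n).foldl (fun acc i => if i ∈ A then acc ||| bit i else acc) 0)` is `decide (i ∈ A)`. -/
theorem mem_maskOf (A : Finset (Fin n)) (i : Fin n) : mem i (((List.finRange n).foldl (fun acc i => if i ∈ A then acc ||| bit i else acc) 0)) = decide (i ∈ A) := by
  rw [mem_foldl_maskOf, mem_zero, Bool.false_or, Bool.eq_iff_iff, List.any_eq_true, decide_eq_true_eq]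
  simp only [List.mem_finRange, true_and, Bool.and_eq_true, decide_eq_true_eq]
  constructor
  · rintro ⟨j, hj, rfl⟩
    exact hj
  · intro h
    exact ⟨i, h, rfl⟩

/-- The `foldl` computing `maskOf` stays below `2 ^ n` when its accumulator does. -/
theorem foldl_maskOf_lt (A : Finset (Fin n)) (L : List (Fin n)) (acc : ℕ) (hacc : acc < 2 ^ n) :
    L.foldl (fun acc j => if j ∈ A then acc ||| bit j else acc) acc < 2 ^ n := by
  induction L generalizing acc with
  | nil => simpa
  | cons j L ih =>
    simp only [List.foldl_cons]
    apply ih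
    split_ifs
    · exact Nat.or_lt_two_pow hacc (bit_lt _)
    · exact hacc

/-- `((List.finRange n).foldl (fun acc i => if i ∈ A then acc ||| bit i else acc) 0)` is below `2 ^ n`. -/
theorem maskOf_lt (A : Finset (Fin n)) : ((List.finRange n).foldl (fun acc i => if i ∈ A then acc ||| bit i else acc) 0) < 2 ^ n := foldl_maskOf_lt A _ 0 (Nat.two_pow_pos n)

end MaskOf

namespace CMGaloisType

variable {n : ℕ} (Γ : CMGaloisType n)

/-- Membership in the transversal `lowerReps`: `a < c a`. -/
theorem mem_lowerReps (a : Fin n) : a ∈ (Finset.univ.filter fun a => a < Γ.mul Γ.conj a) ↔ a < Γ.mul Γ.conj a := by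
  simp

/-- The conjugate of a transversal element is not in the transversal. -/
theorem conj_notMem_lowerReps (hΓ : Γ.isCMGaloisType = true) {a : Fin n} (ha : a ∈ (Finset.univ.filter fun a => a < Γ.mul Γ.conj a)) :
    Γ.mul Γ.conj a ∉ (Finset.univ.filter fun a => a < Γ.mul Γ.conj a) := by
  rw [Γ.mem_lowerReps] at ha ⊢
  rw [(IsGroupTable.conj_mul_conj_mul hΓ)]
  exact not_lt.2 ha.le

/-- Every element or its conjugate lies in the transversal. -/
theorem mem_lowerReps_or_conj (hΓ : Γ.isCMGaloisType = true) (a : Fin n) :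
    a ∈ (Finset.univ.filter fun a => a < Γ.mul Γ.conj a) ∨ Γ.mul Γ.conj a ∈ (Finset.univ.filter fun a => a < Γ.mul Γ.conj a) := by
  rw [Γ.mem_lowerReps, Γ.mem_lowerReps, (IsGroupTable.conj_mul_conj_mul hΓ)]
  rcases lt_trichotomy a (Γ.mul Γ.conj a) with h | h | h
  · exact Or.inl h
  · exact ((IsGroupTable.conj_mul_ne hΓ) a h.symm).elim
  · exact Or.inr h

/-- `Fin n` is the disjoint union of the transversal and its conjugate. -/
theorem card_lowerReps (hΓ : Γ.isCMGaloisType = true) : (Finset.univ.filter fun a => a < Γ.mul Γ.conj a).card = n / 2 := by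
  have himg : ((Finset.univ.filter fun a => a < Γ.mul Γ.conj a).image fun a => Γ.mul Γ.conj a).card = (Finset.univ.filter fun a => a < Γ.mul Γ.conj a).card :=
    Finset.card_image_of_injective _ ((IsGroupTable.mul_left_injective hΓ) Γ.conj)
  have hdisj : Disjoint (Finset.univ.filter fun a => a < Γ.mul Γ.conj a) ((Finset.univ.filter fun a => a < Γ.mul Γ.conj a).image fun a => Γ.mul Γ.conj a) := by
    rw [Finset.disjoint_left]
    intro a ha hb
    rw [Finset.mem_image] at hb
    obtain ⟨b, hb, rfl⟩ := hb
    exact Γ.conj_notMem_lowerReps hΓ hb ha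
  have hunion : (Finset.univ.filter fun a => a < Γ.mul Γ.conj a) ∪ (Finset.univ.filter fun a => a < Γ.mul Γ.conj a).image (fun a => Γ.mul Γ.conj a) = Finset.univ := by
    ext a
    simp only [Finset.mem_union, Finset.mem_image, Finset.mem_univ, iff_true]
    rcases Γ.mem_lowerReps_or_conj hΓ a with h | h
    · exact Or.inl h
    · exact Or.inr ⟨_, h, (IsGroupTable.conj_mul_conj_mul hΓ) a⟩
  have hcard := Finset.card_union_of_disjoint hdisj
  rw [hunion, Finset.card_univ, Fintype.card_fin, himg] at hcard
  omega

/-- The bits of a type on the transversal form a subset of the transversal. -/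
theorem bitsOn_subset (T : ℕ) : ((Finset.univ.filter fun a => a < Γ.mul Γ.conj a).filter fun a => mem a T = true) ⊆ (Finset.univ.filter fun a => a < Γ.mul Γ.conj a) := Finset.filter_subset _ _

/-- A CM type is determined by its bits on the transversal. -/
theorem eq_of_bitsOn_eq (hΓ : Γ.isCMGaloisType = true) {T T' : ℕ} (hT : Γ.isCMType T = true)
    (hT' : Γ.isCMType T' = true) (h : ((Finset.univ.filter fun a => a < Γ.mul Γ.conj a).filter fun a => mem a T = true) = ((Finset.univ.filter fun a => a < Γ.mul Γ.conj a).filter fun a => mem a T' = true)) : T = T' := by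
  apply eq_of_mem_eq (Γ.lt_of_isCMType hT) (Γ.lt_of_isCMType hT')
  have key : ∀ a ∈ (Finset.univ.filter fun a => a < Γ.mul Γ.conj a), mem a T = mem a T' := by
    intro a ha
    have := congrArg (fun S => a ∈ S) h
    simp only [Finset.mem_filter, ha, true_and, eq_iff_iff] at this
    cases h1 : mem a T <;> cases h2 : mem a T' <;> simp_all
  intro i
  rcases Γ.mem_lowerReps_or_conj hΓ i with hi | hi
  · exact key i hi
  · have := key _ hi
    rw [Γ.mem_conj_of_isCMType hT, Γ.mem_conj_of_isCMType hT'] at this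
    exact Bool.not_inj this

/-- Bit `i` of `typeOfBits S`: `i ∈ S`, or `c i` is a transversal element outside `S`. -/
theorem mem_typeOfBits (hΓ : Γ.isCMGaloisType = true) (S : Finset (Fin n)) (i : Fin n) :
    mem i (((List.finRange n).foldl (fun acc i => if i ∈ S ∪ ((Finset.univ.filter fun a => a < Γ.mul Γ.conj a) \ S).image (fun a => Γ.mul Γ.conj a) then acc ||| bit i else acc) 0)) = decide (i ∈ S ∨ (Γ.mul Γ.conj i ∈ (Finset.univ.filter fun a => a < Γ.mul Γ.conj a) ∧ Γ.mul Γ.conj i ∉ S)) := by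
  rw [mem_maskOf]
  congr 1
  apply propext
  simp only [Finset.mem_union, Finset.mem_image, Finset.mem_sdiff]
  constructor
  · rintro (h | ⟨a, ⟨ha, has⟩, rfl⟩)
    · exact Or.inl h
    · right
      rw [(IsGroupTable.conj_mul_conj_mul hΓ)]
      exact ⟨ha, has⟩
  · rintro (h | ⟨h1, h2⟩)
    · exact Or.inl h
    · exact Or.inr ⟨_, ⟨h1, h2⟩, (IsGroupTable.conj_mul_conj_mul hΓ) i⟩

/-- `typeOfBits S` is a CM type for every `S ⊆ lowerReps`. -/
theorem isCMType_typeOfBits (hΓ : Γ.isCMGaloisType = true) {S : Finset (Fin n)} (hS : S ⊆ (Finset.univ.filter fun a => a < Γ.mul Γ.conj a)) :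
    Γ.isCMType (((List.finRange n).foldl (fun acc i => if i ∈ S ∪ ((Finset.univ.filter fun a => a < Γ.mul Γ.conj a) \ S).image (fun a => Γ.mul Γ.conj a) then acc ||| bit i else acc) 0)) = true := by
  rw [Γ.isCMType_iff]
  refine ⟨maskOf_lt _, fun i => ?_⟩
  rw [Γ.mem_typeOfBits hΓ S, Γ.mem_typeOfBits hΓ S, (IsGroupTable.conj_mul_conj_mul hΓ)]
  rcases Γ.mem_lowerReps_or_conj hΓ i with hi | hi
  · have hci : Γ.mul Γ.conj i ∉ (Finset.univ.filter fun a => a < Γ.mul Γ.conj a) := Γ.conj_notMem_lowerReps hΓ hi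
    have hciS : Γ.mul Γ.conj i ∉ S := fun h => hci (hS h)
    by_cases h : i ∈ S <;> simp [h, hci, hciS, hi]
  · have hii : i ∉ (Finset.univ.filter fun a => a < Γ.mul Γ.conj a) := by
      intro h
      exact Γ.conj_notMem_lowerReps hΓ h hi
    have hiS : i ∉ S := fun h => hii (hS h)
    by_cases h : Γ.mul Γ.conj i ∈ S <;> simp [h, hi, hiS, hii]

/-- `bitsOn` is a left inverse of `typeOfBits` on subsets of the transversal. -/
theorem bitsOn_typeOfBits (hΓ : Γ.isCMGaloisType = true) {S : Finset (Fin n)} (hS : S ⊆ (Finset.univ.filter fun a => a < Γ.mul Γ.conj a)) :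
    ((Finset.univ.filter fun a => a < Γ.mul Γ.conj a).filter fun a => mem a (((List.finRange n).foldl (fun acc i => if i ∈ S ∪ ((Finset.univ.filter fun a => a < Γ.mul Γ.conj a) \ S).image (fun a => Γ.mul Γ.conj a) then acc ||| bit i else acc) 0)) = true) = S := by
  ext a
  rw [Finset.mem_filter, Γ.mem_typeOfBits hΓ S]
  constructor
  · rintro ⟨ha, h⟩
    rw [decide_eq_true_eq] at h
    rcases h with h | ⟨h1, -⟩
    · exact h
    · exact (Γ.conj_notMem_lowerReps hΓ ha h1).elim
  · intro h
    exact ⟨hS h, by simp [h]⟩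

/-- The CM types as a finset. -/
theorem cmTypes_nodup : Γ.cmTypes.Nodup := List.Nodup.filter _ List.nodup_range

/-- The CM types are in bijection (via `bitsOn`) with the subsets of the transversal. -/
theorem cmTypes_toFinset_card (hΓ : Γ.isCMGaloisType = true) :
    Γ.cmTypes.toFinset.card = (Finset.univ.filter fun a => a < Γ.mul Γ.conj a).powerset.card := by
  apply Finset.card_bij (fun T _ => ((Finset.univ.filter fun a => a < Γ.mul Γ.conj a).filter fun a => mem a T = true))
  · intro T hT
    exact Finset.mem_powerset.2 (Γ.bitsOn_subset T)
  · intro T hT T' hT' h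
    rw [List.mem_toFinset, Γ.mem_cmTypes] at hT hT'
    exact Γ.eq_of_bitsOn_eq hΓ hT hT' h
  · intro S hS
    rw [Finset.mem_powerset] at hS
    exact ⟨((List.finRange n).foldl (fun acc i => if i ∈ S ∪ ((Finset.univ.filter fun a => a < Γ.mul Γ.conj a) \ S).image (fun a => Γ.mul Γ.conj a) then acc ||| bit i else acc) 0), by rw [List.mem_toFinset, Γ.mem_cmTypes]; exact Γ.isCMType_typeOfBits hΓ hS,
      Γ.bitsOn_typeOfBits hΓ hS⟩

/-- **Count of CM types.** `Γ.cmTypes.length = 2 ^ (n / 2)` for every Galois CM type `(G, c)` of order `n`. -/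
theorem cmTypes_length (hΓ : Γ.isCMGaloisType = true) : Γ.cmTypes.length = 2 ^ (n / 2) := by
  rw [← List.toFinset_card_of_nodup Γ.cmTypes_nodup, Γ.cmTypes_toFinset_card hΓ, Finset.card_powerset,
    Γ.card_lowerReps hΓ]

end CMGaloisType

end Summit.Ventures.HodgeRepro.FaceCensus
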